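import Summits.HodgeConjecture.HodgeConjecture.Theorems.LinearSystemTorelliTranscendentalOrSupportedStubCorrTail
import Summits.HodgeConjecture.HodgeConjecture.Theorems.LinearSystemTorelliTranscendentalOrSupportedStubCorrDiagonal
import Summits.HodgeConjecture.HodgeConjecture.Theorems.LinearSystemTorelliTranscendentalOrSupportedStubCorrActionType
import Summits.HodgeConjecture.HodgeConjecture.Theorems.LinearSystemTorelliTranscendentalOrSupportedStubCorrActionRat
import Summits.HodgeConjecture.HodgeConjecture.Theorems.LinearSystemTorelliTranscendentalOrSupportedStubImagePhantom
import Summits.HodgeConjecture.HodgeConjecture.Theorems.LinearSystemTorelliTranscendentalOrSupportedStubIsotypicAlg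
import Literature.AlgebraicGeometry.HodgeTheory.GysinFormalismHodgeOfGysin

/-!
# Crux `TranscendentalOrSupported` (stmt-HodgeConjecture-10853) — line `Sketch_chow_shadow`, skeleton v2.1
# (cohomological transcendental decomposition of the diagonal)

Route `LinearSystemTorelli`, crux `TranscendentalOrSupported` = GHC(2p, coniveau 1) in Grothendieck's
sub-Hodge form: for `X` smooth projective of dimension `2p` (`p ≥ 1`), a Hodge model `A`, rational
classes `b j ∈ H²ᵖ(X(ℂ); ℂ)` whose pulled-back span `W` is a sub-Hodge structure with
`W ∩ H^{2p,0} = 0`, every `b j` lies in `N¹ H²ᵖ = supportedClasses X (2p) 1`.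

THE LINE (card `Ideas/chow-shadow-bloch-srinivas.md`, ideator sketch `Sketch_chow_shadow`). Apply the
Bloch–Srinivas decomposition not to the diagonal but to `Δ_X − Γ` for a self-correspondence `Γ`
CARRYING the transcendental cohomology: if `Γ` acts as the identity on `CH₀(X)_ℚ`, Bloch–Srinivas
(Voisin II Thm. 10.19, `Y' = ∅`) makes `m(Δ_X − Γ)` rationally equivalent to a cycle supported on
`T × X`, `T ⊊ X` closed, so `[Δ − Γ]^*` maps `H²ᵖ(X)` into `N¹H²ᵖ(X)`; if moreover
`[Γ]^* H²ᵖ(X) ⊆ T(X) + Alg²ᵖ(X)` (`T(X)` = the transcendental part, the smallest rational sub-Hodge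
structure containing `H^{2p,0}`), then EVERY rational sub-Hodge structure of `H²ᵖ(X)` without
`(2p,0)`-part lies in `N¹` ("transcendental decomposition of the diagonal", TDD(X); on K3 squares
`X = S × S` this is Voisin's 1996 conjecture (inv2), Laterveer 2016/2019).

THIS SKELETON is the COHOMOLOGICAL SHADOW of that mechanism, entirely on the tree's real carriers
(`complexGysin μ`, `corrAction μ` = `γ ↦ (c ↦ pr_{1*}(pr_2^* c ∪ γ))`, `supportedClasses`,
`algebraicClasses`, `HodgeModel`, `IsRationalClass`); the Chow level (the identity among `0`-cycles
and Bloch–Srinivas itself) is how `stub_cohTDD` is meant to be established in instances — in the tree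
it would additionally need the hypothesis structures `GysinFormalism` (cycle classes, Fulton Ch. 19)
and `CorrespondenceChowAction` (Fulton Ch. 16), whose intended instances are not constructed, so it
is NOT part of the registered composition. Stubs:

* `stub_corrTail` — a class `γ` on `W ⊗ X` dying on `((W ∖ T) × X)(ℂ)` acts into `N¹Hᵇ(W)`
  (`T` closed of codimension `≥ 1`): Voisin II (10.8) in support form, for the REAL `corrAction`.
* `stub_corrDiagonal` — the Gysin image `δ_X = Δ_* 1` of `1` under the diagonal acts as the identity
  (Voisin I §11.3.3), for the REAL `complexGysin μ` / `corrAction μ`.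
* `stub_corrActionType` — for `γ` ALGEBRAIC of codimension `dim X` on `X ⊗ X`, `γ^*` has Hodge
  bidegree `(0,0)` read in a fixed Hodge model (Voisin I §7.3.2, Lemma 11.41).
* `stub_corrActionRat` — for `γ` RATIONAL, `γ^*` maps rational classes to rational classes up to ONE
  non-zero scalar (the orientation constant of `complexGysin μ`).
* `stub_imagePhantom` — lattice algebra: a type-`(0,0)`, rational-up-to-scalar endomorphism maps a
  rationally spanned sub-Hodge subspace without `(k,0)`-part to another such.
* `stub_isotypicAlg` — the isotypic lemma: if `im f ⊆ T(X) + Algᵖ(X)` (spelled definition-free: `im f`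
  lies in EVERY rationally spanned sub-Hodge `V` containing `H^{2p,0}` and `Algᵖ(X)`) and `f(W)` sits
  in a rationally spanned sub-Hodge `M` without `(2p,0)`-part, then `f(W) ⊆ Algᵖ(X)` (semisimplicity
  of polarisable Hodge structures: `stub_completelyReducible` p107582 + polarizability p112211).
* `stub_cohTDD` — THE BET (∀ `X`): a rational algebraic `γ` on `X ⊗ X` and a scalar `t` with
  `δ_X − t•γ` dying off `T × X` for a closed `T` of codimension `≥ 1`, and `im γ^* ⊆ T(X) + Algᵖ(X)`.
  Implied by TDD(X) (Bloch–Srinivas); implies the crux AND the route item `MiddleDivisorSupport` at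
  `X`; open (it contains Voisin's (inv2) for every K3 surface).

Composition: `TranscendentalOrSupported_of` (PROVED here from the six lemma stubs and `stub_cohTDD`:
`b j = (δ − tγ)^* b j + t • γ^* b j ∈ N¹ + N^p ⊆ N¹`).
-/

noncomputable section

set_option linter.dupNamespace false

open CategoryTheory MonoidalCategory CartesianMonoidalCategory
open Literature.AlgebraicGeometry.Motives Literature.AlgebraicGeometry.HodgeTheory
open Literature.AlgebraicTopology.SingularHomology

namespace Summit.HodgeConjecture.HodgeConjecture.Cruxes.TranscendentalOrSupported.ChowShadow

/-! ### Registered stubs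

LANDED (wave 1 of lead a1, theorems of the tree, namespace `Summit.HodgeConjecture.HodgeConjecture.Theorems`):
`stub_corrTail` p122948, `stub_corrDiagonal` p122958, `stub_corrActionType` p122961, `stub_corrActionRat`
p122994, `stub_imagePhantom` p123120, `stub_isotypicAlg` p123346. OPEN: `stub_cohTDD` (the bet).
ASSEMBLY in hypothesis form (registered stub `stub_transcendentalOrSupported_of_cohTDD : CohTDD → crux`, with the
per-variety form `transcendentalOrSupportedAt_of_cohTDDAt` and `middleDivisorSupport_of_cohTDD`): LANDED p123745 as
`Theorems/LinearSystemTorelliTranscendentalOrSupportedOfCohTDD.lean`; `TranscendentalOrSupported_of` below is the same proof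
inlined (v3 = one-line call of the landed assembly, to be published once the farm has built that module). -/

/-- CLOSED STUB `stub_corrTail` (LANDED as `Theorems.stub_corrTail`, p122948) (Voisin II (10.8) in support form, for the tree's REAL correspondence action
`corrAction μ`, first factor receives): if `γ ∈ H^{2e}((W ⊗ X)(ℂ); ℂ)` restricts to `0` on the
complex points of the complement of `pr_W⁻¹ T`, `T ⊆ W` Zariski-closed all of whose points have
codimension `≥ 1`, then `γ^*(c) = pr_{W*}(pr_X^* c ∪ γ)` lies in `N¹ Hᵇ(W(ℂ); ℂ)` for every `c`:
`pr_X^* c ∪ γ` dies where `γ` dies (naturality of `∪`), and `pr_{W*}` of a class dying off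
`pr_W⁻¹ T` dies off `T` (`complexGysin_restrictCompl_eq_zero` with the PROVED
`gysinMap_restrictCompl_eq_zero_of_field ℂ`), hence `mem_supportedClasses_of_restrictCompl_eq_zero`. -/
theorem stub_corrTail :
    ∀ (μ : OrientationFamily) ⦃m n : ℕ⦄ ⦃W X : SchemeOver ℂ⦄ (hW : IsSmoothProjective m W)
    (hX : IsSmoothProjective n X) ⦃e a b : ℕ⦄ (hab : a + 2 * e = b + 2 * n) ⦃T : Set W.left⦄,
    IsClosed T → (∀ z ∈ T, (1 : ℕ∞) ≤ Order.coheight z) →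
    ∀ ⦃γ : complexBetti (W ⊗ X) (2 * e)⦄,
    complexBetti.restrictCompl (W ⊗ X) ((fst W X).left.base ⁻¹' T) (2 * e) γ = 0 →
    ∀ c : complexBetti X a, corrAction μ hW hX hab γ c ∈ supportedClasses W b 1 :=
  Summit.HodgeConjecture.HodgeConjecture.Theorems.stub_corrTail

/-- CLOSED STUB `stub_corrDiagonal` (LANDED as `Theorems.stub_corrDiagonal`, p122958) (`[Δ_X]^* = Id` for the REAL Gysin morphisms, Voisin I §11.3.3 / Voisin II
proof of Thm. 10.17): the Gysin image `δ_X = Δ_* 1 ∈ H^{2n}((X ⊗ X)(ℂ); ℂ)` of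
`1 ∈ H⁰(X(ℂ); ℂ)` under the diagonal `Δ = (𝟙, 𝟙) : X ⟶ X ⊗ X` acts as the identity on
`Hᵏ(X(ℂ); ℂ)`: `pr_{1*}(pr_2^* c ∪ Δ_* 1) = pr_{1*} Δ_*(Δ^* pr_2^* c ∪ 1) = (Δ ≫ pr₁)_* ((Δ ≫ pr₂)^* c) = c`
by the projection formula `complexGysin_cup`, functoriality `complexGysin_comp`/`complexGysin_id`
(Poincaré duality `OrientationFamily.hasPoincareDuality μ`), `lift_fst`, `lift_snd`, `cupProduct_one`
— the proof of `GysinFormalism.corrAct_primeCycle_diagonal` with `G.gysin` replaced by `complexGysin μ`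
and `cl[Δ]` by `Δ_* 1`. -/
theorem stub_corrDiagonal :
    ∀ (μ : OrientationFamily) ⦃n : ℕ⦄ ⦃X : SchemeOver ℂ⦄ (hX : IsSmoothProjective n X) (k : ℕ)
    (hδ : 0 + 2 * (n + n) = 2 * n + 2 * n) (hab : k + 2 * n = k + 2 * n),
    corrAction μ hX hX hab
      (complexGysin μ hX (IsSmoothProjective.tensor_holds hX hX) (lift (𝟙 X) (𝟙 X)) hδ
        (singularCohomology.one ℂ (ComplexPoints X))) = LinearMap.id :=
  Summit.HodgeConjecture.HodgeConjecture.Theorems.stub_corrDiagonal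

/-- CLOSED STUB `stub_corrActionType` (LANDED as `Theorems.stub_corrActionType`, p122961) (an algebraic self-correspondence acts with Hodge bidegree `(0,0)`,
read in a fixed Hodge model; Voisin I §7.3.2 and Lemma 11.41): for `γ ∈ algebraicClasses (X ⊗ X) n`
(`n = dim X`, so `γ ∈ H^{2n}((X ⊗ X)(ℂ))` is of Hodge type `(n,n)` by the tree's
`isOfHodgeType_of_mem_algebraicClasses_of_isSmoothProjective`) and `c ∈ Hᵏ(X(ℂ); ℂ)` with
`A^* c ∈ H^{p',q'}`, also `A^*(γ^* c) ∈ H^{p',q'}`: `pr_2^* c` is of type `(p',q')`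
(`IsOfHodgeType.map_of_independent`), `pr_2^* c ∪ γ` of type `(p'+n, q'+n)`
(`cupPreservesHodgeType_of_nonempty_hodgeModel`), and `pr_{1*}` shifts types by `(-n,-n)`
(`isOfHodgeType_complexGysin`); all fed with the theorems `hodgePQ_independent_of_hodgeModel_holds`,
`nonempty_hodgeModel_holds`, `exists_deRhamIsoFamily_holds`, and read back in `A` by
`hodgePQ_independent_of_hodgeModel_holds.isOfHodgeType_iff`. -/
theorem stub_corrActionType :
    ∀ (μ : OrientationFamily) ⦃n : ℕ⦄ ⦃X : SchemeOver ℂ⦄ (hX : IsSmoothProjective n X)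
    (A : HodgeModel n X) ⦃k : ℕ⦄ (hab : k + 2 * n = k + 2 * n) ⦃γ : complexBetti (X ⊗ X) (2 * n)⦄,
    γ ∈ algebraicClasses (X ⊗ X) n →
    ∀ ⦃p' q' : ℕ⦄ ⦃c : complexBetti X k⦄, A.pullback k c ∈ A.hodgePQ k p' q' →
    A.pullback k (corrAction μ hX hX hab γ c) ∈ A.hodgePQ k p' q' :=
  Summit.HodgeConjecture.HodgeConjecture.Theorems.stub_corrActionType

/-- CLOSED STUB `stub_corrActionRat` (LANDED as `Theorems.stub_corrActionRat`, p122994) (a rational self-correspondence acts on rational classes rationally, up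
to ONE non-zero scalar): for `γ ∈ H^{2n}((X ⊗ X)(ℂ); ℂ)` rational there is `u ≠ 0` with
`γ^* c ∈ u • {rational classes}` for every rational `c ∈ Hᵏ(X(ℂ); ℂ)`: `pr_2^* c` is rational
(`IsRationalClass.pullback`), `pr_2^* c ∪ γ` is rational (`IsRationalClass.cup`), and on rational
classes `pr_{1*} = complexGysin μ …` is the rational Gysin homomorphism up to one non-zero scalar
(`complexGysin_ringChange_eq_smul_gysinMap`, with `exists_ratOrientation_hasPoincareDuality`,
`IsRationalClass.exists_ringChange_eq`, `isRationalClass_ringChange`); in degrees beyond the top,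
`pr_{1*} = 0` (`complexGysin_of_lt`). Template: `Theorems.gysinRangeRational_apply_mem_span`. -/
theorem stub_corrActionRat :
    ∀ (μ : OrientationFamily) ⦃n : ℕ⦄ ⦃X : SchemeOver ℂ⦄ (hX : IsSmoothProjective n X)
    ⦃k : ℕ⦄ (hab : k + 2 * n = k + 2 * n) ⦃γ : complexBetti (X ⊗ X) (2 * n)⦄, IsRationalClass γ →
    ∃ u : ℂ, u ≠ 0 ∧ ∀ c : complexBetti X k, IsRationalClass c →
      ∃ c' : complexBetti X k, IsRationalClass c' ∧ corrAction μ hX hX hab γ c = u • c' :=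
  Summit.HodgeConjecture.HodgeConjecture.Theorems.stub_corrActionRat

/-- CLOSED STUB `stub_imagePhantom` (LANDED as `Theorems.stub_imagePhantom`, p123120) (lattice algebra of Hodge structures, Voisin I §7.3.1): an endomorphism
`f` of `Hᵏ(X(ℂ); ℂ)` of Hodge bidegree `(0,0)` in the model `A` that maps rational classes to
rational classes up to one non-zero scalar sends a rationally spanned subspace `W` whose pull-back
to `A` is a sub-Hodge structure WITHOUT `(k,0)`-part to a subspace `f(W)` with the same three
properties: `f(W)` is spanned by the rational classes `u⁻¹ f(w)`, `w ∈ W` rational; the Hodge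
components of `A^*(f w) = Σ f(w_{p',q'})` lie in `A^*(f W)`; and an element of `A^*(f W) ∩ H^{k,0}`
is `A^* f(w_{k,0})` with `w_{k,0} ∈ A^* W ∩ H^{k,0} = 0` (directness of the Hodge decomposition,
`HodgeModel.isInternal_hodgePQ` / `eq_zero_of_mem_hodgePQ_two_mul`-type lemmas). -/
theorem stub_imagePhantom :
    ∀ ⦃n : ℕ⦄ ⦃X : SchemeOver ℂ⦄ (hX : IsSmoothProjective n X) (A : HodgeModel n X) ⦃k : ℕ⦄
    (f : complexBetti X k →ₗ[ℂ] complexBetti X k),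
    (∀ ⦃p' q' : ℕ⦄ ⦃c : complexBetti X k⦄, A.pullback k c ∈ A.hodgePQ k p' q' →
      A.pullback k (f c) ∈ A.hodgePQ k p' q') →
    (∃ u : ℂ, u ≠ 0 ∧ ∀ c : complexBetti X k, IsRationalClass c →
      ∃ c' : complexBetti X k, IsRationalClass c' ∧ f c = u • c') →
    ∀ (W : Submodule ℂ (complexBetti X k)),
    Submodule.span ℂ {x : complexBetti X k | x ∈ W ∧ IsRationalClass x} = W →
    W.map (A.pullback k).hom =
      ⨆ (p' : ℕ) (q' : ℕ) (_ : p' + q' = k), W.map (A.pullback k).hom ⊓ A.hodgePQ k p' q' →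
    W.map (A.pullback k).hom ⊓ A.hodgePQ k k 0 = ⊥ →
    Submodule.span ℂ {x : complexBetti X k | x ∈ W.map f ∧ IsRationalClass x} = W.map f ∧
    (W.map f).map (A.pullback k).hom =
      ⨆ (p' : ℕ) (q' : ℕ) (_ : p' + q' = k), (W.map f).map (A.pullback k).hom ⊓ A.hodgePQ k p' q' ∧
    (W.map f).map (A.pullback k).hom ⊓ A.hodgePQ k k 0 = ⊥ :=
  Summit.HodgeConjecture.HodgeConjecture.Theorems.stub_imagePhantom

/-- CLOSED STUB `stub_isotypicAlg` (LANDED as `Theorems.stub_isotypicAlg`, p123346) (the isotypic lemma; semisimplicity of polarisable Hodge structures,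
Voisin I Lemma 7.26 / §7.3.1): let `f` be an endomorphism of `H²ᵖ(X(ℂ); ℂ)` whose image lies in
`T(X) + Algᵖ(X)` — spelled WITHOUT naming the transcendental part `T(X)`: `im f ≤ V` for EVERY
rationally spanned `V` whose pull-back to `A` is a sub-Hodge structure containing `H^{2p,0}` and
which contains `Algᵖ(X) = algebraicClasses X p` (the smallest such `V` is `T(X) + Algᵖ(X)`) — and let
`W` be a subspace with `f(W) ≤ M` for a rationally spanned sub-Hodge `M` without `(2p,0)`-part. Then
`f(W) ≤ Algᵖ(X)`. Proof: `M₁ := M ⊔ Algᵖ(X)` is rationally spanned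
(`supportedClasses_eq_span_isRationalClass`), sub-Hodge (algebraic classes are of type `(p,p)`,
`isOfHodgeType_of_mem_algebraicClasses_of_isSmoothProjective`) and without `(2p,0)`-part (`p ≥ 1`);
by `Theorems.stub_completelyReducible` (fed with `smoothProjective_hodgeStructure_isPolarizable_holds`)
applied to `M₁ ≤ ⊤` (`⊤` is rationally spanned, `span_isRationalClass_eq_top_of_isSmoothProjective_holds`,
and sub-Hodge by the Hodge decomposition) there is a rationally spanned sub-Hodge `M₁'` with
`M₁ ⊓ M₁' = ⊥`, `M₁ ⊔ M₁' = ⊤`, and `H^{2p,0} ≤ A^* M₁'` (the `(2p,0)`-component of an element of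
`A^* M₁` vanishes); `V := M₁' ⊔ Algᵖ(X)` qualifies, so `f w = m' + a` with `m' ∈ M₁'`, `a ∈ Algᵖ(X)`,
and `m' = f w − a ∈ M₁ ⊓ M₁' = ⊥`. -/
theorem stub_isotypicAlg :
    ∀ ⦃p : ℕ⦄ ⦃X : SchemeOver ℂ⦄, 1 ≤ p → ∀ (hX : IsSmoothProjective (2 * p) X)
    (A : HodgeModel (2 * p) X) (f : complexBetti X (2 * p) →ₗ[ℂ] complexBetti X (2 * p))
    (W M : Submodule ℂ (complexBetti X (2 * p))),
    Submodule.span ℂ {x : complexBetti X (2 * p) | x ∈ M ∧ IsRationalClass x} = M →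
    M.map (A.pullback (2 * p)).hom =
      ⨆ (p' : ℕ) (q' : ℕ) (_ : p' + q' = 2 * p), M.map (A.pullback (2 * p)).hom ⊓ A.hodgePQ (2 * p) p' q' →
    M.map (A.pullback (2 * p)).hom ⊓ A.hodgePQ (2 * p) (2 * p) 0 = ⊥ →
    W.map f ≤ M →
    (∀ V : Submodule ℂ (complexBetti X (2 * p)),
      Submodule.span ℂ {x : complexBetti X (2 * p) | x ∈ V ∧ IsRationalClass x} = V →
      V.map (A.pullback (2 * p)).hom =
        ⨆ (p' : ℕ) (q' : ℕ) (_ : p' + q' = 2 * p), V.map (A.pullback (2 * p)).hom ⊓ A.hodgePQ (2 * p) p' q' →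
      A.hodgePQ (2 * p) (2 * p) 0 ≤ V.map (A.pullback (2 * p)).hom →
      algebraicClasses X p ≤ V →
      LinearMap.range f ≤ V) →
    W.map f ≤ algebraicClasses X p :=
  Summit.HodgeConjecture.HodgeConjecture.Theorems.stub_isotypicAlg

/-- STUB `stub_cohTDD` — THE BET of the line (∀ `X`; lead): **cohomological transcendental
decomposition of the diagonal.** For every smooth projective `X` of dimension `2p` (`p ≥ 1`) and
Hodge model `A` there are an orientation family `μ`, a RATIONAL ALGEBRAIC class
`γ ∈ H^{4p}((X ⊗ X)(ℂ); ℂ)` (the class of a codimension-`2p` cycle `Γ` with `ℚ`-coefficients), a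
scalar `t` — no normalisation on `t` (it absorbs the orientation constant of `δ_X`), and a Zariski-closed
`T ⊆ X` of codimension `≥ 1`, such that (i) `δ_X − t•γ` dies on `((X ∖ T) × X)(ℂ)` — the
cohomological shadow, via Lemma 9.18 and the support of cycle classes, of Bloch–Srinivas'
`m(Δ_X − Γ) ≡ Z'` supported on `T × X` for a `Γ` acting as the identity on `CH₀(X)_ℚ` — and
(ii) `im γ^* ⊆ T(X) + Algᵖ(X)` on `H²ᵖ(X(ℂ); ℂ)` (definition-free spelling as in `stub_isotypicAlg`).
Status: implies the crux at `X` (this file) AND `MiddleDivisorSupport` at `X` (same argument on Hodge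
classes), hence OPEN ∀X; at `X = S × S`, `S` a K3 surface, it follows from Voisin's conjecture (inv2)
(proved: Kummer, two-cubic double planes, `ρ ≥ 19`, …; open for `ρ(S) < 9`). -/
theorem stub_cohTDD :
    ∀ ⦃p : ℕ⦄ ⦃X : SchemeOver ℂ⦄, 1 ≤ p → ∀ (hX : IsSmoothProjective (2 * p) X)
    (A : HodgeModel (2 * p) X) (hδ : 0 + 2 * (2 * p + 2 * p) = 2 * (2 * p) + 2 * (2 * p))
    (hab : 2 * p + 2 * (2 * p) = 2 * p + 2 * (2 * p)),
    ∃ (μ : OrientationFamily) (γ : complexBetti (X ⊗ X) (2 * (2 * p))) (t : ℂ) (T : Set X.left),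
      IsRationalClass γ ∧ γ ∈ algebraicClasses (X ⊗ X) (2 * p) ∧ IsClosed T ∧
      (∀ z ∈ T, (1 : ℕ∞) ≤ Order.coheight z) ∧
      complexBetti.restrictCompl (X ⊗ X) ((fst X X).left.base ⁻¹' T) (2 * (2 * p))
        (complexGysin μ hX (IsSmoothProjective.tensor_holds hX hX) (lift (𝟙 X) (𝟙 X)) hδ
          (singularCohomology.one ℂ (ComplexPoints X)) - t • γ) = 0 ∧
      (∀ V : Submodule ℂ (complexBetti X (2 * p)),
        Submodule.span ℂ {x : complexBetti X (2 * p) | x ∈ V ∧ IsRationalClass x} = V →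
        V.map (A.pullback (2 * p)).hom =
          ⨆ (p' : ℕ) (q' : ℕ) (_ : p' + q' = 2 * p),
            V.map (A.pullback (2 * p)).hom ⊓ A.hodgePQ (2 * p) p' q' →
        A.hodgePQ (2 * p) (2 * p) 0 ≤ V.map (A.pullback (2 * p)).hom →
        algebraicClasses X p ≤ V →
        LinearMap.range (corrAction μ hX hX hab γ) ≤ V) := by
  sorry

/-! ### Remark: clause (i) of `stub_cohTDD` alone is trivially satisfiable (the content is clause (ii)) -/

/-- **Where the content of `stub_cohTDD` sits.** Clause (i) ALONE — "`δ_X − t•γ` dies off `T × X` for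
a rational algebraic `γ`, a scalar `t` and a closed `T` of codimension `≥ 1`" — holds on every smooth
projective `X` with `T = ∅`: `δ_X = Δ_* 1` is algebraic (`complexGysin_mem_algebraicClasses`, `1`
being algebraic in codimension `0`) and equals `u • ρ` for ONE rational class `ρ` and `u ≠ 0`
(`complexGysin_ringChange_eq_smul_gysinMap` on `1 = ι 1_ℚ`), so `γ := ρ = u⁻¹ • δ_X`, `t := u` give
`δ_X − t•γ = 0`. Hence all the content of `stub_cohTDD` is in clause (ii) for a `γ` congruent to
`t⁻¹ δ_X` modulo classes dying off `T × X` — with `T = ∅` clause (ii) says `T(X) + Algᵖ(X) = H²ᵖ(X)`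
(no phantoms and all middle Hodge classes algebraic), the phantom-free sector of the dead line
`Sketch` (`Theorems.isotypic_le_supportedClasses_of_noPhantom`). -/
theorem remark_cohTDD_clause_i_trivial (μ : OrientationFamily) {p : ℕ} {X : SchemeOver ℂ}
    (hX : IsSmoothProjective (2 * p) X)
    (hδ : 0 + 2 * (2 * p + 2 * p) = 2 * (2 * p) + 2 * (2 * p)) :
    ∃ (γ : complexBetti (X ⊗ X) (2 * (2 * p))) (t : ℂ) (T : Set X.left),
      IsRationalClass γ ∧ γ ∈ algebraicClasses (X ⊗ X) (2 * p) ∧ IsClosed T ∧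
      (∀ z ∈ T, (1 : ℕ∞) ≤ Order.coheight z) ∧
      complexBetti.restrictCompl (X ⊗ X) ((fst X X).left.base ⁻¹' T) (2 * (2 * p))
        (complexGysin μ hX (IsSmoothProjective.tensor_holds hX hX) (lift (𝟙 X) (𝟙 X)) hδ
          (singularCohomology.one ℂ (ComplexPoints X)) - t • γ) = 0 := by
  have hXX := IsSmoothProjective.tensor_holds hX hX
  -- `δ_X` is algebraic
  have halg : complexGysin μ hX hXX (lift (𝟙 X) (𝟙 X)) hδ (singularCohomology.one ℂ (ComplexPoints X)) ∈
      algebraicClasses (X ⊗ X) (2 * p) := by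
    have h1 : singularCohomology.one ℂ (ComplexPoints X) ∈ algebraicClasses X 0 := by
      rw [algebraicClasses_zero]; exact Submodule.mem_top
    exact complexGysin_mem_algebraicClasses (gysinMap_restrictCompl_eq_zero_of_field ℂ) μ
      μ.hasPoincareDuality hX hXX (lift (𝟙 X) (𝟙 X)) (q := 0) (p := 2 * p) (by omega)
      (show 2 * 0 + 2 * (2 * p + 2 * p) = 2 * (2 * p) + 2 * (2 * p) by omega) h1
  -- `δ_X = u • ρ` with `ρ` rational
  obtain ⟨νY⟩ := Literature.AlgebraicGeometry.Motives.ComplexPoints.isOrientableOver ℚ hX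
  obtain ⟨νX, hνX⟩ := exists_ratOrientation_hasPoincareDuality hXX
  obtain ⟨u, hu0, hu⟩ := complexGysin_ringChange_eq_smul_gysinMap (μ := μ) μ.hasPoincareDuality
    hX hXX (lift (𝟙 X) (𝟙 X)) (a := 0) (b := 2 * (2 * p)) (q := 2 * (2 * p)) (by omega) (by omega) νY νX hνX
  obtain ⟨y, hy⟩ := (isRationalClass_one (ComplexPoints X)).exists_ringChange_eq
  obtain ⟨ρ, hρ, hδρ⟩ : ∃ ρ : complexBetti (X ⊗ X) (2 * (2 * p)), IsRationalClass ρ ∧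
      complexGysin μ hX hXX (lift (𝟙 X) (𝟙 X)) hδ (singularCohomology.one ℂ (ComplexPoints X)) = u • ρ :=
    ⟨_, isRationalClass_ringChange _, by rw [← hy]; exact hu y⟩
  refine ⟨ρ, u, ∅, hρ, ?_, isClosed_empty, fun z hz ↦ (Set.notMem_empty z hz).elim, ?_⟩
  · -- `ρ = u⁻¹ • δ_X` is algebraic
    have : ρ = u⁻¹ • complexGysin μ hX hXX (lift (𝟙 X) (𝟙 X)) hδ (singularCohomology.one ℂ (ComplexPoints X)) := by
      rw [hδρ, smul_smul, inv_mul_cancel₀ hu0, one_smul]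
    rw [this]
    exact Submodule.smul_mem _ _ halg
  · rw [hδρ, sub_self, map_zero]

/-! ### The assembly (proved from the stubs) -/

/-- The span of finitely many rational classes is spanned by its rational classes. -/
theorem span_isRationalClass_inter_span_eq {X : SchemeOver ℂ} {k r : ℕ}
    {b : Fin r → complexBetti X k} (hb : ∀ j, IsRationalClass (b j)) :
    Submodule.span ℂ {x : complexBetti X k | x ∈ Submodule.span ℂ (Set.range b) ∧ IsRationalClass x} =
      Submodule.span ℂ (Set.range b) := by
  refine le_antisymm (Submodule.span_le.2 fun x hx ↦ hx.1) (Submodule.span_mono ?_)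
  rintro _ ⟨j, rfl⟩
  exact ⟨Submodule.subset_span ⟨j, rfl⟩, hb j⟩

/-! ### The crux by name (the assembly, proved from the stubs) -/

/-- **The crux `TranscendentalOrSupported` from the stubs** (line `Sketch_chow_shadow`, skeleton v1;
the ONLY theorem of this file concluding the crux — the line's reduction "cohomological TDD ⟹ crux"):
every `b j` of the crux lies in `N¹`: `b j = (δ_X − t•γ)^*(b j) + t • γ^*(b j)` (`stub_corrDiagonal`,
linearity of `corrAction` in `γ`); the first summand lies in `N¹` (`stub_corrTail`); `γ^*` maps the
span `W` of the `b j` — rationally spanned, sub-Hodge, without `(2p,0)`-part — into such an `M`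
(`stub_imagePhantom` with `stub_corrActionType`, `stub_corrActionRat`), hence into `Algᵖ(X)`
(`stub_isotypicAlg`, fed with the `T(X) + Alg` clause of `stub_cohTDD`), and
`Algᵖ(X) = Nᵖ H²ᵖ ≤ N¹ H²ᵖ` for `p ≥ 1` (`supportedClasses_mono`). The hypothesis form
`CohTDD → TranscendentalOrSupported` is landed separately as a Theorems file once the lemma stubs land. -/
theorem TranscendentalOrSupported_of :
    Summit.HodgeConjecture.HodgeConjecture.Theses.LinearSystemTorelli.TranscendentalOrSupported := by
  intro p X hp hX A r b hb hsub h20 j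
  have hδ : 0 + 2 * (2 * p + 2 * p) = 2 * (2 * p) + 2 * (2 * p) := by omega
  have hab : 2 * p + 2 * (2 * p) = 2 * p + 2 * (2 * p) := rfl
  obtain ⟨μ, γ, t, T, hγrat, hγalg, hT, hT1, hsupp, hrange⟩ := stub_cohTDD hp hX A hδ hab
  set δ : complexBetti (X ⊗ X) (2 * (2 * p)) :=
    complexGysin μ hX (IsSmoothProjective.tensor_holds hX hX) (lift (𝟙 X) (𝟙 X)) hδ
      (singularCohomology.one ℂ (ComplexPoints X)) with hδdef
  -- the decomposition `b j = (δ − t•γ)^*(b j) + t • γ^*(b j)`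
  have hid : corrAction μ hX hX hab δ = LinearMap.id := stub_corrDiagonal μ hX (2 * p) hδ hab
  have hdec : b j = corrAction μ hX hX hab (δ - t • γ) (b j) + t • corrAction μ hX hX hab γ (b j) := by
    rw [map_sub, map_smul, LinearMap.sub_apply, LinearMap.smul_apply, hid, LinearMap.id_apply,
      sub_add_cancel]
  -- the supported part
  have h1 : corrAction μ hX hX hab (δ - t • γ) (b j) ∈ supportedClasses X (2 * p) 1 :=
    stub_corrTail μ hX hX hab hT hT1 hsupp (b j)
  -- the transcendental part: `γ^*` maps `W = span (b j)` into `Algᵖ(X)`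
  have h2 : corrAction μ hX hX hab γ (b j) ∈ algebraicClasses X p := by
    set W : Submodule ℂ (complexBetti X (2 * p)) := Submodule.span ℂ (Set.range b) with hWdef
    have hWrat := span_isRationalClass_inter_span_eq hb
    obtain ⟨hMrat, hMsub, hM0⟩ := stub_imagePhantom hX A (corrAction μ hX hX hab γ)
      (stub_corrActionType μ hX A hab hγalg) (stub_corrActionRat μ hX hab hγrat) W hWrat hsub h20
    have hle : W.map (corrAction μ hX hX hab γ) ≤ algebraicClasses X p :=
      stub_isotypicAlg hp hX A (corrAction μ hX hX hab γ) W (W.map (corrAction μ hX hX hab γ))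
        hMrat hMsub hM0 le_rfl hrange
    exact hle (Submodule.mem_map_of_mem (Submodule.subset_span ⟨j, rfl⟩))
  rw [hdec]
  refine Submodule.add_mem _ h1 (Submodule.smul_mem _ t ?_)
  exact supportedClasses_mono X (2 * p) hp h2

end Summit.HodgeConjecture.HodgeConjecture.Cruxes.TranscendentalOrSupported.ChowShadow

end
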